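import Summits.RiemannHypothesis.RiemannHypothesis.Theorems.EtaLeadingQuarterWeakLockingLayerEstimates
import Summits.RiemannHypothesis.RiemannHypothesis.Theses.EtaLeadingQuarter
import Literature.NumberTheory.LFunctions.MontgomeryZeroSideProofs

/-!
# The weak locking layer, III: `WeakLockingLayer` holds
(route EtaLeadingQuarter, item `WeakLockingLayer`, stmt-RiemannHypothesis-21792)

RH-FREE. With the explicit log-scale Gaussian layer `e_M` of
`EtaLeadingQuarterWeakLockingLayerConstruction.lean` (`s_M² = (log M)/150`, centre `(9/10) log M`,
amplitude fixed by exact locking) and `L = log M ≥ 150`: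
`(M/log M) · ∑_ρ m(ρ) γ^{-2} |∑_m e_M(m) m^{iγ}|²
   ≤ 162 B₀ e^{−23L/75} + 72π e^{−L/15} + 448 A L² e^{−11L/60} + 0.408 e^{−L/5} → 0`
(`B₀ = ∑_ρ m/γ²`, `A` the local zero-density constant of the tree's
`Montgomery.exists_zetaZeroCount_add_one_sub_le`), the energy is `≤ 1/D_M ≤ e^{−271L/300}`, and the
locking is exact for `M ≥ 2`. Hence
`theorem weakLockingLayer_proof : Summit.RiemannHypothesis.RiemannHypothesis.Theses.EtaLeadingQuarter.WeakLockingLayer`.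

This closes crux r3 of route EtaLeadingQuarter (a rung route onto the RH-free leaf
`ScrewFloorLimsupQuarter`); it proves nothing about RH. Nothing here bears on the truth of RH.
-/

noncomputable section

open Complex MeasureTheory Set Filter Finset intervalIntegral
open scoped Real Topology ComplexConjugate

set_option linter.dupNamespace false  -- the mandated namespace repeats `RiemannHypothesis`

namespace Summit.RiemannHypothesis.RiemannHypothesis.Theorems.EtaLeadingQuarter.Locking

open Literature.NumberTheory.LFunctions NicolasJExplicit SchoenfeldBound ZetaZeroTails
open Summit.RiemannHypothesis.RiemannHypothesis.Theorems.EtaLeadingQuarter.LockingEngine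
open Summit.RiemannHypothesis.RiemannHypothesis.Theorems.EtaLeadingQuarter.ZeroSide

/-! ## Exponentials as powers of `q = e^{L/300}` -/

/-- `e^{(k/300) L} = q^k` for `q = e^{L/300}`. [folklore] -/
theorem exp_eq_pow (L : ℝ) (k : ℕ) (c : ℝ) (hc : c = k / 300) :
    Real.exp (c * L) = Real.exp (L / 300) ^ k := by
  rw [← Real.exp_nat_mul, hc]; ring_nf

/-- `e^{-(k/300) L} = (q^k)⁻¹` for `q = e^{L/300}`. [folklore] -/
theorem exp_neg_eq_pow (L : ℝ) (k : ℕ) (c : ℝ) (hc : c = k / 300) :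
    Real.exp (-c * L) = (Real.exp (L / 300) ^ k)⁻¹ := by
  rw [← Real.exp_nat_mul, ← Real.exp_neg, hc]; ring_nf

/-! ## The low-range constant -/

/-- `α ≤ 9 s e^{L/4}` for `α = (√(2π)s + 1)e^{L/4} + 1 + 2√π` (`s ≥ 1`). [folklore] -/
theorem alpha_le {M : ℕ} (hL : 150 ≤ Real.log M) :
    (Real.sqrt (2 * π) * width M + 1) * Real.exp (Real.log M / 4) + 1 + 2 * Real.sqrt π ≤
      9 * width M * Real.exp (Real.log M / 4) := by
  obtain ⟨-, h3, hπ⟩ := sqrt_two_pi_bounds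
  have hs := one_le_width hL
  have hE : 1 ≤ Real.exp (Real.log M / 4) := Real.one_le_exp (by linarith)
  have hs0 : 0 ≤ width M := by linarith
  have h1 : (Real.sqrt (2 * π) * width M + 1) * Real.exp (Real.log M / 4) ≤
      (3 * width M + 1) * Real.exp (Real.log M / 4) := by
    gcongr
  have h2 : 1 + 2 * Real.sqrt π ≤ 5 * (width M * Real.exp (Real.log M / 4)) := by
    have : 1 ≤ width M * Real.exp (Real.log M / 4) := one_le_mul_of_one_le_of_one_le hs hE
    linarith
  nlinarith

/-! ## The master bound -/


/-- Term 1 of the master bound, as pure algebra in `q = e^{L/300}`. [folklore] -/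
theorem algT1 {q s L D B₀ α : ℝ} (hq : 0 < q) (hs : 1 ≤ s) (hL : 1 ≤ L) (hB : 0 ≤ B₀) (hα0 : 0 ≤ α)
    (hα : α ≤ 9 * s * q ^ 75) (hD : s * q ^ 271 ≤ D) :
    q ^ 300 / L * ((D ^ 2)⁻¹ * (2 * α ^ 2 * B₀)) ≤ 162 * B₀ * (q ^ 92)⁻¹ := by
  have hs0 : 0 < s := by linarith
  have hD0 : 0 < D := lt_of_lt_of_le (by positivity) hD
  have hD2 : (D ^ 2)⁻¹ ≤ ((s * q ^ 271) ^ 2)⁻¹ :=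
    inv_anti₀ (by positivity) (pow_le_pow_left₀ (by positivity) hD 2)
  have hα2 : α ^ 2 ≤ (9 * s * q ^ 75) ^ 2 := pow_le_pow_left₀ hα0 hα 2
  calc q ^ 300 / L * ((D ^ 2)⁻¹ * (2 * α ^ 2 * B₀))
      ≤ q ^ 300 / 1 * (((s * q ^ 271) ^ 2)⁻¹ * (2 * (9 * s * q ^ 75) ^ 2 * B₀)) := by
        gcongr
    _ = 162 * B₀ * (q ^ 92)⁻¹ := by field_simp; ring

/-- Term 2 of the master bound, as pure algebra in `q = e^{L/300}`. [folklore] -/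
theorem algT2 {q s L D : ℝ} (hq : 0 < q) (hs : 1 ≤ s) (hL : 1 ≤ L) (hD : s * q ^ 271 ≤ D) :
    q ^ 300 / L * ((D ^ 2)⁻¹ * (4 * (2 * π * s ^ 2) * (9 * L * q ^ 222))) ≤ 72 * π * (q ^ 20)⁻¹ := by
  have hs0 : 0 < s := by linarith
  have hD0 : 0 < D := lt_of_lt_of_le (by positivity) hD
  have hD2 : (D ^ 2)⁻¹ ≤ ((s * q ^ 271) ^ 2)⁻¹ :=
    inv_anti₀ (by positivity) (pow_le_pow_left₀ (by positivity) hD 2)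
  calc q ^ 300 / L * ((D ^ 2)⁻¹ * (4 * (2 * π * s ^ 2) * (9 * L * q ^ 222)))
      ≤ q ^ 300 / L * (((s * q ^ 271) ^ 2)⁻¹ * (4 * (2 * π * s ^ 2) * (9 * L * q ^ 222))) := by
        gcongr
    _ = 72 * π * (q ^ 20)⁻¹ := by field_simp; ring

/-- Term 3 of the master bound, as pure algebra in `q = e^{L/300}`. [folklore] -/
theorem algT3 {q s L D A : ℝ} (hq : 1 ≤ q) (hs : 1 ≤ s) (hL : 1 ≤ L) (hA : 0 ≤ A) (hD : s * q ^ 271 ≤ D)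
    (hlog : Real.log (q ^ 360 + 4) ≤ 2 * L) (hlog0 : 0 ≤ Real.log (q ^ 360 + 4)) :
    q ^ 300 / L * ((D ^ 2)⁻¹ * (2 * ((q ^ 222) ^ 2)⁻¹ * (2 * A * Real.log (q ^ 360 + 4)) *
      ((5 * (q ^ 360 + 1) + 18 * q ^ 300) * ((3 / 2 + L ^ 2 / 2) * D)))) ≤
      448 * A * (L ^ 2 * (q ^ 55)⁻¹) := by
  have hq0 : 0 < q := by linarith
  have hs0 : 0 < s := by linarith
  have hD0 : 0 < D := lt_of_lt_of_le (by positivity) hD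
  have hD1 : D⁻¹ ≤ (q ^ 271)⁻¹ :=
    inv_anti₀ (by positivity) ((le_mul_of_one_le_left (by positivity) hs).trans hD)
  have h28 : 5 * (q ^ 360 + 1) + 18 * q ^ 300 ≤ 28 * q ^ 360 := by
    have h1 : q ^ 300 ≤ q ^ 360 := pow_le_pow_right₀ hq (by norm_num)
    have h2 : (1 : ℝ) ≤ q ^ 360 := one_le_pow₀ hq
    linarith
  have hL2 : 3 / 2 + L ^ 2 / 2 ≤ 2 * L ^ 2 := by nlinarith
  have e : (D ^ 2)⁻¹ * (2 * ((q ^ 222) ^ 2)⁻¹ * (2 * A * Real.log (q ^ 360 + 4)) *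
      ((5 * (q ^ 360 + 1) + 18 * q ^ 300) * ((3 / 2 + L ^ 2 / 2) * D))) =
      D⁻¹ * (2 * ((q ^ 222) ^ 2)⁻¹ * (2 * A * Real.log (q ^ 360 + 4)) *
        ((5 * (q ^ 360 + 1) + 18 * q ^ 300) * (3 / 2 + L ^ 2 / 2))) := by
    field_simp
  rw [e]
  calc q ^ 300 / L * (D⁻¹ * (2 * ((q ^ 222) ^ 2)⁻¹ * (2 * A * Real.log (q ^ 360 + 4)) *
        ((5 * (q ^ 360 + 1) + 18 * q ^ 300) * (3 / 2 + L ^ 2 / 2))))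
      ≤ q ^ 300 / L * ((q ^ 271)⁻¹ * (2 * ((q ^ 222) ^ 2)⁻¹ * (2 * A * (2 * L)) *
        ((28 * q ^ 360) * (2 * L ^ 2)))) := by gcongr
    _ = 448 * A * (L ^ 2 * (q ^ 55)⁻¹) := by field_simp; ring

/-- Term 4 of the master bound, as pure algebra in `q = e^{L/300}`. [folklore] -/
theorem algT4 {q L D : ℝ} (hq : 0 < q) (hL : 1 ≤ L) (hD : 0 < D) :
    q ^ 300 / L * ((D ^ 2)⁻¹ * (D ^ 2 * (0.34 * (6 / 5 * L) / q ^ 360))) = 0.408 * (q ^ 60)⁻¹ := by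
  field_simp
  ring

/-- `A_M² ≤ 1/D_M²` (`|L_M| ≤ 1`). [folklore] -/
theorem amp_sq_le {M : ℕ} (hD0 : 0 < mass M) : amp M ^ 2 ≤ (mass M ^ 2)⁻¹ := by
  have h := abs_lockConst_le M
  have h0 := abs_nonneg (lockConst M)
  have e : amp M ^ 2 = lockConst M ^ 2 / mass M ^ 2 := by rw [amp, div_pow]
  rw [e, div_le_iff₀ (by positivity), inv_mul_cancel₀ (by positivity), ← sq_abs]
  nlinarith

/-- The master bound as pure algebra in `q = e^{L/300}`: from `Z ≤ P₁ + P₂ + P₃ + P₄` (the three-range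
bound), `A_M² ≤ 1/D²`, `D ≥ s q^{271}`, `α ≤ 9 s q^{75}` to the four error terms. [folklore] -/
theorem master_alg {q s L D A B₀ Z ampsq : ℝ} (hq1 : 1 ≤ q) (hs1 : 1 ≤ s) (hL1 : 1 ≤ L) (hA0 : 0 ≤ A)
    (hB₀0 : 0 ≤ B₀) (hZ0 : 0 ≤ Z) (hD : s * q ^ 271 ≤ D) (hamp : ampsq ≤ (D ^ 2)⁻¹)
    (h4 : 4 ≤ q ^ 360) (hlog : Real.log (q ^ 360 + 4) ≤ 2 * L)
    (hα9 : (Real.sqrt (2 * π) * s + 1) * q ^ 75 + 1 + 2 * Real.sqrt π ≤ 9 * s * q ^ 75)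
    (hZ : Z ≤ 2 * ((Real.sqrt (2 * π) * s + 1) * q ^ 75 + 1 + 2 * Real.sqrt π) ^ 2 * B₀ +
        4 * (2 * π * s ^ 2) * (9 * L * q ^ 222) +
      2 * ((q ^ 222) ^ 2)⁻¹ * (2 * A * Real.log (q ^ 360 + 4)) *
        ((5 * (q ^ 360 + 1) + 18 * q ^ 300) * ((3 / 2 + L ^ 2 / 2) * D)) +
      D ^ 2 * (0.34 * (6 / 5 * L) / q ^ 360)) :
    q ^ 300 / L * (ampsq * Z) ≤
      162 * B₀ * (q ^ 92)⁻¹ + 72 * π * (q ^ 20)⁻¹ + 448 * A * (L ^ 2 * (q ^ 55)⁻¹) + 0.408 * (q ^ 60)⁻¹ := by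
  have hq0 : 0 < q := by linarith
  have hs0 : 0 < s := by linarith
  have hD0 : 0 < D := lt_of_lt_of_le (by positivity) hD
  have hα0 : 0 ≤ (Real.sqrt (2 * π) * s + 1) * q ^ 75 + 1 + 2 * Real.sqrt π := by positivity
  have hlog0 : 0 ≤ Real.log (q ^ 360 + 4) := Real.log_nonneg (by linarith)
  have hP₁0 : 0 ≤ 2 * ((Real.sqrt (2 * π) * s + 1) * q ^ 75 + 1 + 2 * Real.sqrt π) ^ 2 * B₀ := by
    positivity
  have hP₂0 : 0 ≤ 4 * (2 * π * s ^ 2) * (9 * L * q ^ 222) := by positivity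
  have hP₃0 : 0 ≤ 2 * ((q ^ 222) ^ 2)⁻¹ * (2 * A * Real.log (q ^ 360 + 4)) *
      ((5 * (q ^ 360 + 1) + 18 * q ^ 300) * ((3 / 2 + L ^ 2 / 2) * D)) := by positivity
  have hP₄0 : 0 ≤ D ^ 2 * (0.34 * (6 / 5 * L) / q ^ 360) := by positivity
  have hT1 := algT1 hq0 hs1 hL1 hB₀0 hα0 hα9 hD
  have hT2 := algT2 hq0 hs1 hL1 hD
  have hT3 := algT3 hq1 hs1 hL1 hA0 hD hlog hlog0
  have hT4 := algT4 hq0 hL1 hD0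
  have hML : 0 ≤ q ^ 300 / L := by positivity
  have hred : q ^ 300 / L * (ampsq * Z) ≤ q ^ 300 / L * ((D ^ 2)⁻¹ *
      (2 * ((Real.sqrt (2 * π) * s + 1) * q ^ 75 + 1 + 2 * Real.sqrt π) ^ 2 * B₀ +
        4 * (2 * π * s ^ 2) * (9 * L * q ^ 222) +
      2 * ((q ^ 222) ^ 2)⁻¹ * (2 * A * Real.log (q ^ 360 + 4)) *
        ((5 * (q ^ 360 + 1) + 18 * q ^ 300) * ((3 / 2 + L ^ 2 / 2) * D)) +
      D ^ 2 * (0.34 * (6 / 5 * L) / q ^ 360))) :=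
    mul_le_mul_of_nonneg_left (mul_le_mul hamp hZ hZ0 (by positivity)) hML
  have hsplit : q ^ 300 / L * ((D ^ 2)⁻¹ *
      (2 * ((Real.sqrt (2 * π) * s + 1) * q ^ 75 + 1 + 2 * Real.sqrt π) ^ 2 * B₀ +
        4 * (2 * π * s ^ 2) * (9 * L * q ^ 222) +
      2 * ((q ^ 222) ^ 2)⁻¹ * (2 * A * Real.log (q ^ 360 + 4)) *
        ((5 * (q ^ 360 + 1) + 18 * q ^ 300) * ((3 / 2 + L ^ 2 / 2) * D)) +
      D ^ 2 * (0.34 * (6 / 5 * L) / q ^ 360))) =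
      q ^ 300 / L * ((D ^ 2)⁻¹ * (2 * ((Real.sqrt (2 * π) * s + 1) * q ^ 75 + 1 + 2 * Real.sqrt π) ^ 2 * B₀)) +
      q ^ 300 / L * ((D ^ 2)⁻¹ * (4 * (2 * π * s ^ 2) * (9 * L * q ^ 222))) +
      q ^ 300 / L * ((D ^ 2)⁻¹ * (2 * ((q ^ 222) ^ 2)⁻¹ * (2 * A * Real.log (q ^ 360 + 4)) *
        ((5 * (q ^ 360 + 1) + 18 * q ^ 300) * ((3 / 2 + L ^ 2 / 2) * D)))) +
      q ^ 300 / L * ((D ^ 2)⁻¹ * (D ^ 2 * (0.34 * (6 / 5 * L) / q ^ 360))) := by ring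
  rw [hsplit, hT4] at hred
  linarith

/-- **Master bound at a fixed large `M`.** For `log M = L ≥ 150` and the local density constant `A`:
`(M/L) ∑'_ρ m γ^{-2} ‖∑_m e_M(m) m^{iγ}‖²
  ≤ 162 B₀ e^{−23L/75} + 72π e^{−L/15} + 448 A L² e^{−11L/60} + 0.408 e^{−L/5}`. [folklore] -/
theorem master_le {M : ℕ} (hL : 150 ≤ Real.log M) {A : ℝ} (hA0 : 0 ≤ A)
    (hA : ∀ t : ℝ, 0 ≤ t → (zetaZeroCount (t + 1) : ℝ) - zetaZeroCount t ≤ A * Real.log (t + 2)) :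
    (M : ℝ) / Real.log M * ∑' ρ : ZetaZeros.riemannZetaNontrivialZeros,
        (riemannZetaZeroOrder (ρ : ℂ) : ℝ) / (ρ : ℂ).im ^ 2 *
          ‖∑ m ∈ Finset.Icc 2 M, ((layer M m : ℝ) : ℂ) * (m : ℂ) ^ ((((ρ : ℂ).im : ℝ) : ℂ) * I)‖ ^ 2 ≤
      162 * (∑' ρ : Zeros, (riemannZetaZeroOrder (ρ : ℂ) : ℝ) / (ρ : ℂ).im ^ 2) *
          Real.exp (-(23 / 75) * Real.log M) +
        72 * π * Real.exp (-(1 / 15) * Real.log M) +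
        448 * A * (Real.log M ^ 2 * Real.exp (-(11 / 60) * Real.log M)) +
        0.408 * Real.exp (-(1 / 5) * Real.log M) := by
  have hα9 := alpha_le hL
  have hs1 : 1 ≤ width M := one_le_width hL
  have hD := mass_ge' hL
  -- `A_M² ≤ 1/D²`
  have hD0 : 0 < mass M := lt_of_lt_of_le (by positivity) hD
  have hamp : amp M ^ 2 ≤ (mass M ^ 2)⁻¹ := amp_sq_le hD0
  have hB₀0 : 0 ≤ ∑' ρ : Zeros, (riemannZetaZeroOrder (ρ : ℂ) : ℝ) / (ρ : ℂ).im ^ 2 :=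
    tsum_nonneg fun ρ ↦ zeroOrder_div_im_sq_nonneg ρ
  have hZ0 : 0 ≤ ∑' ρ : Zeros, (riemannZetaZeroOrder (ρ : ℂ) : ℝ) / (ρ : ℂ).im ^ 2 *
      ‖dirPoly (coeff M) M (ρ : ℂ).im‖ ^ 2 :=
    tsum_nonneg fun ρ ↦ mul_nonneg (zeroOrder_div_im_sq_nonneg ρ) (sq_nonneg _)
  have hL1 : 1 ≤ Real.log M := by linarith
  have hM0 : (0 : ℝ) < M := by
    have : (1 : ℝ) ≤ M := by
      by_contra h
      rw [not_le] at h
      have : Real.log (M : ℝ) ≤ 0 := Real.log_nonpos (Nat.cast_nonneg M) h.le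
      linarith
    linarith
  -- exponentials as powers of `q = e^{L/300}` (a genuinely free variable, keeping `q ^ 360` opaque)
  obtain ⟨q, hq⟩ : ∃ q : ℝ, Real.exp (Real.log M / 300) = q := ⟨_, rfl⟩
  have hq1 : 1 ≤ q := by rw [← hq]; exact Real.one_le_exp (by positivity)
  have eM : (M : ℝ) = q ^ 300 := by
    rw [← hq, ← Real.exp_nat_mul]
    rw [show ((300 : ℕ) : ℝ) * (Real.log M / 300) = Real.log M by push_cast; ring, Real.exp_log hM0]
  have e271 : Real.exp (271 / 300 * Real.log M) = q ^ 271 := by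
    rw [exp_eq_pow (Real.log M) 271 _ (by norm_num), hq]
  have e75 : Real.exp (Real.log M / 4) = q ^ 75 := by
    rw [show Real.log M / 4 = (75 / 300 : ℝ) * Real.log M by ring,
      exp_eq_pow (Real.log M) 75 _ (by norm_num), hq]
  have e222 : Real.exp (37 / 50 * Real.log M) = q ^ 222 := by
    rw [exp_eq_pow (Real.log M) 222 _ (by norm_num), hq]
  have e360 : Real.exp (6 / 5 * Real.log M) = q ^ 360 := by
    rw [exp_eq_pow (Real.log M) 360 _ (by norm_num), hq]
  have en92 : Real.exp (-(23 / 75) * Real.log M) = (q ^ 92)⁻¹ := by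
    rw [exp_neg_eq_pow (Real.log M) 92 _ (by norm_num), hq]
  have en20 : Real.exp (-(1 / 15) * Real.log M) = (q ^ 20)⁻¹ := by
    rw [exp_neg_eq_pow (Real.log M) 20 _ (by norm_num), hq]
  have en55 : Real.exp (-(11 / 60) * Real.log M) = (q ^ 55)⁻¹ := by
    rw [exp_neg_eq_pow (Real.log M) 55 _ (by norm_num), hq]
  have en60 : Real.exp (-(1 / 5) * Real.log M) = (q ^ 60)⁻¹ := by
    rw [exp_neg_eq_pow (Real.log M) 60 _ (by norm_num), hq]
  have h4 : (4 : ℝ) ≤ q ^ 360 := by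
    have h := Real.add_one_le_exp (6 / 5 * Real.log M)
    rw [e360] at h; linarith
  have e240 : Real.exp (4 / 5 * Real.log M) = q ^ 240 := by
    rw [exp_eq_pow (Real.log M) 240 _ (by norm_num), hq]
  have hlog : Real.log (q ^ 360 + 4) ≤ 2 * Real.log M := by
    have hq0 : 0 < q := by linarith
    have h240 : (2 : ℝ) ≤ q ^ 240 := by
      have h := Real.add_one_le_exp (4 / 5 * Real.log M)
      rw [e240] at h; linarith
    have h1 : q ^ 360 + 4 ≤ q ^ 360 * q ^ 240 := by
      have := mul_le_mul h4 h240 (by norm_num) (by positivity : (0 : ℝ) ≤ q ^ 360)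
      nlinarith
    have h2 : Real.log (q ^ 360 * q ^ 240) = 2 * Real.log M := by
      rw [← e360, ← e240, ← Real.exp_add, Real.log_exp]; ring
    calc Real.log (q ^ 360 + 4) ≤ Real.log (q ^ 360 * q ^ 240) :=
          Real.log_le_log (by positivity) h1
      _ = 2 * Real.log M := h2
  have hβ2 : (Real.sqrt (2 * π) * width M) ^ 2 = 2 * π * width M ^ 2 := by
    rw [mul_pow, Real.sq_sqrt (by positivity)]
  have e18 : (18 : ℝ) * (M : ℝ) = 18 * q ^ 300 := by rw [eM]
  rw [e75] at hα9
  rw [e271] at hD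
  have hZ := zeroSide_le hL hA0 hA
  rw [e75, e222, e360, hβ2, e18] at hZ
  rw [tsum_layer_eq, en92, en20, en55, en60, show (M : ℝ) / Real.log M = q ^ 300 / Real.log M by rw [eM]]
  exact master_alg hq1 hs1 hL1 hA0 hB₀0 hZ0 hD hamp h4 hlog hα9 hZ

/-! ## The limit -/

/-- The four error terms tend to `0` along `L → ∞`. [folklore] -/
theorem tendsto_errorTerms (B₀ A : ℝ) :
    Tendsto (fun L : ℝ ↦ 162 * B₀ * Real.exp (-(23 / 75) * L) + 72 * π * Real.exp (-(1 / 15) * L) +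
        448 * A * (L ^ 2 * Real.exp (-(11 / 60) * L)) + 0.408 * Real.exp (-(1 / 5) * L)) atTop (𝓝 0) := by
  have h0 : ∀ b : ℝ, 0 < b → Tendsto (fun L : ℝ ↦ Real.exp (-b * L)) atTop (𝓝 0) := by
    intro b hb
    have h := tendsto_rpow_mul_exp_neg_mul_atTop_nhds_zero 0 b hb
    refine h.congr' ?_
    filter_upwards [eventually_gt_atTop 0] with L hL
    rw [Real.rpow_zero, one_mul]
  have h2 : Tendsto (fun L : ℝ ↦ L ^ 2 * Real.exp (-(11 / 60) * L)) atTop (𝓝 0) := by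
    have h := tendsto_rpow_mul_exp_neg_mul_atTop_nhds_zero 2 (11 / 60) (by norm_num)
    refine h.congr' ?_
    filter_upwards [eventually_gt_atTop 0] with L hL
    rw [Real.rpow_two]
  have := (((h0 _ (by norm_num : (0:ℝ) < 23 / 75)).const_mul (162 * B₀)).add
    ((h0 _ (by norm_num : (0:ℝ) < 1 / 15)).const_mul (72 * π))).add
    (h2.const_mul (448 * A)) |>.add ((h0 _ (by norm_num : (0:ℝ) < 1 / 5)).const_mul 0.408)
  simpa using this

/-- `log M → ∞` along the naturals. [folklore] -/
theorem tendsto_log_natCast : Tendsto (fun M : ℕ ↦ Real.log (M : ℝ)) atTop atTop :=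
  Real.tendsto_log_atTop.comp tendsto_natCast_atTop_atTop

/-- **`WeakLockingLayer` (item stmt-RiemannHypothesis-21792) holds**, witnessed by the explicit
log-scale Gaussian layer `Locking.layer`. RH-free; nothing here bears on the truth of RH. [folklore] -/
theorem weakLockingLayer_proof :
    Summit.RiemannHypothesis.RiemannHypothesis.Theses.EtaLeadingQuarter.WeakLockingLayer := by
  unfold Summit.RiemannHypothesis.RiemannHypothesis.Theses.EtaLeadingQuarter.WeakLockingLayer
  obtain ⟨A, hA0, hA⟩ := Montgomery.exists_zetaZeroCount_add_one_sub_le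
  have h150 : ∀ᶠ M : ℕ in atTop, 150 ≤ Real.log (M : ℝ) := tendsto_log_natCast.eventually_ge_atTop 150
  refine ⟨layer, ?_, ?_, ?_⟩
  · -- exact locking
    filter_upwards [eventually_ge_atTop 2] with M hM
    exact sum_layer hM
  · -- energy: `0 ≤ ∑ e² / log M ≤ 1/D_M ≤ e^{-271 L/300} → 0`
    have hup : Tendsto (fun M : ℕ ↦ Real.exp (-(271 / 300 * Real.log (M : ℝ)))) atTop (𝓝 0) :=
      Real.tendsto_exp_neg_atTop_nhds_zero.comp (tendsto_log_natCast.const_mul_atTop (by norm_num))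
    refine tendsto_of_tendsto_of_tendsto_of_le_of_le' tendsto_const_nhds hup ?_ ?_
    · filter_upwards [h150] with M hM
      exact div_nonneg (Finset.sum_nonneg fun m _ ↦ sq_nonneg _) (by linarith)
    · filter_upwards [h150] with M hM
      have hs1 := one_le_width hM
      have hD := mass_ge' hM
      have hE := Real.exp_pos (271 / 300 * Real.log (M : ℝ))
      have hD0 : 0 < mass M := lt_of_lt_of_le (by positivity) hD
      have hM2 : 2 ≤ M := by
        by_contra h
        rw [not_le] at h
        interval_cases M <;> simp at hM <;> linarith [Real.log_two_lt_d9]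
      have h1 := sum_layer_sq_le hM2
      have hL := abs_lockConst_le M
      have h2 : lockConst M ^ 2 / mass M ≤ 1 / mass M := by
        refine div_le_div_of_nonneg_right ?_ hD0.le
        rw [← sq_abs]; nlinarith [abs_nonneg (lockConst M)]
      have h3 : 1 / mass M ≤ Real.exp (-(271 / 300 * Real.log (M : ℝ))) := by
        rw [Real.exp_neg, one_div]
        exact inv_anti₀ hE ((le_mul_of_one_le_left hE.le hs1).trans hD)
      have h4 : (∑ m ∈ Finset.Icc 2 M, layer M m ^ 2) / Real.log M ≤ ∑ m ∈ Finset.Icc 2 M, layer M m ^ 2 :=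
        div_le_self (Finset.sum_nonneg fun m _ ↦ sq_nonneg _) (by linarith)
      linarith
  · -- the zero side
    have hup : Tendsto (fun M : ℕ ↦
        162 * (∑' ρ : Zeros, (riemannZetaZeroOrder (ρ : ℂ) : ℝ) / (ρ : ℂ).im ^ 2) *
            Real.exp (-(23 / 75) * Real.log M) +
          72 * π * Real.exp (-(1 / 15) * Real.log M) +
          448 * A * (Real.log M ^ 2 * Real.exp (-(11 / 60) * Real.log M)) +
          0.408 * Real.exp (-(1 / 5) * Real.log M)) atTop (𝓝 0) :=
      (tendsto_errorTerms _ A).comp tendsto_log_natCast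
    refine tendsto_of_tendsto_of_tendsto_of_le_of_le' tendsto_const_nhds hup ?_ ?_
    · filter_upwards [h150] with M hM
      rw [tsum_layer_eq]
      refine mul_nonneg (div_nonneg (Nat.cast_nonneg M) (by linarith)) (mul_nonneg (sq_nonneg _) ?_)
      exact tsum_nonneg fun ρ ↦ mul_nonneg (zeroOrder_div_im_sq_nonneg ρ) (sq_nonneg _)
    · filter_upwards [h150] with M hM
      exact master_le hM hA0.le hA

end Summit.RiemannHypothesis.RiemannHypothesis.Theorems.EtaLeadingQuarter.Locking

end
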